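import Mathlib.MeasureTheory.Integral.Prod
import Mathlib.MeasureTheory.Measure.Lebesgue.Basic
import Mathlib.Analysis.SpecialFunctions.Integrals.Basic
import Literature.Probability.Process.BrownianGrowthAtZero
import HarnessLib

/-!
# The time integral `∫₀ᵗ B_s ds` of Brownian motion: mean and variance (Durrett, Exercise 7.1.3)

Topic: Probability / stochastic processes. Durrett, §7.1, Exercises:

> «**7.1.3.** Let `W = ∫_0^t B_s ds`. Find `EW` and `EW²`. What is the distribution of `W`?»

Answer (as computed here): `EW = 0` and `EW² = t³/3` (and `W ~ N(0, t³/3)`, not treated).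

## Formalization

For a pre-Brownian motion `B` on `(Ω, P)` which is jointly measurable in `(s, ω)` (e.g. the
canonical `brownian`, continuous in `s`), `W(ω) = ∫_{s ∈ (0,t]} B_{s} ω ds` (real times read
through `s ↦ s.toNNReal`).  `E[B_s B_u] = min(s,u)` (Mathlib `IsPreBrownianReal.covariance_eval`,
`IsPreBrownianReal.integral_mul_eval`); `(s, ω) ↦ B_s ω` is integrable on `(0,t] × Ω`
(`E|B_s| ≤ (1+s)/2`), so Fubini gives `EW = ∫₀ᵗ E B_s ds = 0`
(`IsPreBrownianReal.integral_timeIntegral_eq_zero`); `W² = ∫∫ B_s B_u ds du` and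
`(s, u, ω) ↦ B_s ω B_u ω` is integrable on `(0,t]² × Ω` (`E|B_s B_u| ≤ (s+u)/2`), so
`EW² = ∫₀ᵗ∫₀ᵗ min(s,u) du ds = ∫₀ᵗ (s²/2 + s(t−s)) ds = t³/3`
(`IsPreBrownianReal.integral_timeIntegral_sq`).

| Durrett (2019), §7.1, Exercise 7.1.3 | here | status |
|---|---|---|
| `E[B_s B_u] = s ∧ u` | `IsPreBrownianReal.integral_mul_eval` | proved |
| `EW = 0` | `IsPreBrownianReal.integral_timeIntegral_eq_zero`, `Durrett2019_exercise_7_1_3_mean` | proved |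
| `∫₀ᵗ∫₀ᵗ (s ∧ u) du ds = t³/3` | `integral_Ioc_integral_Ioc_min` | proved |
| `EW² = t³/3` | `IsPreBrownianReal.integral_timeIntegral_sq`, `Durrett2019_exercise_7_1_3_sq` | proved |

Not here: «What is the distribution of `W`?» (`N(0, t³/3)`, a Gaussian-process fact).

## Mathlib

We USE `IsPreBrownianReal.covariance_eval`, `covariance_eq_sub`, `HasGaussianLaw.memLp_two`,
`integrable_prod_iff`, `integral_integral_swap`, `integral_prod`, `integral_prod_mul`,
`integral_id`, `intervalIntegral.integral_const`,
`integral_pow`, `measurable_uncurry_of_continuous_of_measurable`.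

## References

* R. Durrett, *Probability: Theory and Examples*, 5th ed., Cambridge University Press (2019),
  §7.1, Exercise 7.1.3 (p. 307; PDF p0319).
-/

noncomputable section

open Set Filter MeasureTheory ProbabilityTheory Topology Function
open scoped NNReal ENNReal

namespace Literature.Probability.Process

variable {Ω : Type*} {mΩ : MeasurableSpace Ω} {P : Measure Ω} {B : ℝ≥0 → Ω → ℝ}

/-! ### §1 Second moments of a pre-Brownian motion -/

/-- `E[B_s B_u] = min(s, u)` (from Mathlib's `cov[B_s, B_u] = min(s,u)` and `E B = 0`).
[cite: Durrett2019, §7.1 eq. (7.1.1)–(7.1.2); Ex. 7.1.3] -/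
theorem _root_.ProbabilityTheory.IsPreBrownianReal.integral_mul_eval (hB : IsPreBrownianReal B P)
    (s u : ℝ≥0) : ∫ ω, B s ω * B u ω ∂P = min (s : ℝ) u := by
  haveI := hB.isGaussianProcess.isProbabilityMeasure
  have h := covariance_eq_sub (hB.isGaussianProcess.hasGaussianLaw_eval s).memLp_two
    (hB.isGaussianProcess.hasGaussianLaw_eval u).memLp_two
  rw [hB.covariance_eval, hB.integral_eval, hB.integral_eval, mul_zero, sub_zero] at h
  rw [← NNReal.coe_min, h]
  rfl

/-- `E[B_s²] = s`. [cite: Durrett2019, §7.1; Ex. 7.1.3] -/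
theorem _root_.ProbabilityTheory.IsPreBrownianReal.integral_sq_eval (hB : IsPreBrownianReal B P)
    (s : ℝ≥0) : ∫ ω, B s ω ^ 2 ∂P = s := by
  have h := hB.integral_mul_eval s s
  rw [min_self] at h
  rw [← h]
  exact integral_congr_ae (ae_of_all _ fun ω ↦ by simp [sq])

/-- `B_s B_u` is integrable (polarisation with the squares of Gaussian variables). [folklore] -/
private theorem TimeIntAux.integrable_mul_eval (hB : IsPreBrownianReal B P) (s u : ℝ≥0) :
    Integrable (fun ω ↦ B s ω * B u ω) P := by
  have h2 := (((hB.isGaussianProcess.hasGaussianLaw_eval s).memLp_two).add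
    ((hB.isGaussianProcess.hasGaussianLaw_eval u).memLp_two)).integrable_sq
  have hs := ((hB.isGaussianProcess.hasGaussianLaw_eval s).memLp_two).integrable_sq
  have hu := ((hB.isGaussianProcess.hasGaussianLaw_eval u).memLp_two).integrable_sq
  refine (((h2.sub hs).sub hu).div_const 2).congr (ae_of_all _ fun ω ↦ ?_)
  simp only [Pi.add_apply, Pi.sub_apply]
  ring

/-- `E|B_s B_u| ≤ (s + u)/2`. [folklore] -/
private theorem TimeIntAux.integral_abs_mul_le (hB : IsPreBrownianReal B P) (s u : ℝ≥0) :
    ∫ ω, ‖B s ω * B u ω‖ ∂P ≤ ((s : ℝ) + u) / 2 := by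
  have hs := ((hB.isGaussianProcess.hasGaussianLaw_eval s).memLp_two).integrable_sq
  have hu := ((hB.isGaussianProcess.hasGaussianLaw_eval u).memLp_two).integrable_sq
  calc ∫ ω, ‖B s ω * B u ω‖ ∂P ≤ ∫ ω, (B s ω ^ 2 + B u ω ^ 2) / 2 ∂P := by
        refine integral_mono (TimeIntAux.integrable_mul_eval hB s u).norm
          ((hs.add hu).div_const 2) fun ω ↦ ?_
        simp only [Real.norm_eq_abs]
        rw [abs_mul, ← sq_abs (B s ω), ← sq_abs (B u ω)]
        nlinarith [sq_nonneg (|B s ω| - |B u ω|)]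
    _ = ((s : ℝ) + u) / 2 := by
        rw [integral_div, integral_add hs hu, hB.integral_sq_eval, hB.integral_sq_eval]

/-- `E|B_s| ≤ (1 + s)/2`. [folklore] -/
private theorem TimeIntAux.integral_abs_le (hB : IsPreBrownianReal B P) (s : ℝ≥0) :
    ∫ ω, ‖B s ω‖ ∂P ≤ (1 + (s : ℝ)) / 2 := by
  haveI := hB.isGaussianProcess.isProbabilityMeasure
  have hs := ((hB.isGaussianProcess.hasGaussianLaw_eval s).memLp_two).integrable_sq
  calc ∫ ω, ‖B s ω‖ ∂P ≤ ∫ ω, (1 + B s ω ^ 2) / 2 ∂P := by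
        refine integral_mono (hB.integrable_eval s).norm
          (((integrable_const 1).add hs).div_const 2) fun ω ↦ ?_
        simp only [Real.norm_eq_abs]
        rw [← sq_abs (B s ω)]
        nlinarith [sq_nonneg (|B s ω| - 1)]
    _ = (1 + (s : ℝ)) / 2 := by
        rw [integral_div, integral_add (integrable_const 1) hs, integral_const, hB.integral_sq_eval]
        simp

/-! ### §2 `EW = 0` -/

/-- Joint integrability of `(s, ω) ↦ B_s ω` on `(0, t] × Ω` for a jointly measurable pre-Brownian
motion (`E|B_s| ≤ (1+s)/2`) — the Fubini hypothesis behind `EW = ∫₀ᵗ E B_s ds`.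
[cite: Durrett2019, Ex. 7.1.3] -/
theorem _root_.ProbabilityTheory.IsPreBrownianReal.integrable_uncurry_restrict_Ioc
    (hB : IsPreBrownianReal B P) (hmeas : Measurable (uncurry B)) (t : ℝ) :
    Integrable (uncurry fun (s : ℝ) (ω : Ω) ↦ B s.toNNReal ω)
      ((volume.restrict (Ioc 0 t)).prod P) := by
  haveI := hB.isGaussianProcess.isProbabilityMeasure
  have hm : Measurable (uncurry fun (s : ℝ) (ω : Ω) ↦ B s.toNNReal ω) :=
    hmeas.comp (measurable_real_toNNReal.prodMap measurable_id)
  refine (integrable_prod_iff hm.aestronglyMeasurable).2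
    ⟨Eventually.of_forall fun s ↦ ?_, ?_⟩
  · simp only [uncurry_apply_pair]
    exact hB.integrable_eval _
  refine Integrable.mono' (g := fun _ ↦ (1 + max t 0) / 2) (integrable_const _)
    hm.aestronglyMeasurable.norm.integral_prod_right' ?_
  refine (ae_restrict_mem measurableSet_Ioc).mono fun s hs ↦ ?_
  simp only [uncurry_apply_pair]
  rw [Real.norm_eq_abs, abs_of_nonneg (integral_nonneg fun _ ↦ norm_nonneg _)]
  refine (TimeIntAux.integral_abs_le hB s.toNNReal).trans ?_
  have : ((s.toNNReal : ℝ≥0) : ℝ) ≤ max t 0 := by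
    rw [Real.coe_toNNReal _ hs.1.le]
    exact hs.2.trans (le_max_left _ _)
  linarith

/-- **Exercise 7.1.3, `EW = 0`**: for a jointly measurable pre-Brownian motion,
`E ∫_{(0,t]} B_s ds = ∫_{(0,t]} E B_s ds = 0` (Fubini). [cite: Durrett2019, Ex. 7.1.3] -/
theorem _root_.ProbabilityTheory.IsPreBrownianReal.integral_timeIntegral_eq_zero
    (hB : IsPreBrownianReal B P) (hmeas : Measurable (uncurry B)) (t : ℝ) :
    ∫ ω, (∫ s in Ioc 0 t, B s.toNNReal ω) ∂P = 0 := by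
  haveI := hB.isGaussianProcess.isProbabilityMeasure
  rw [← integral_integral_swap (hB.integrable_uncurry_restrict_Ioc hmeas t)]
  simp [hB.integral_eval]

/-! ### §3 `EW² = t³/3` -/

/-- `∫_{(0,t]} min(s, u) du = s²/2 + s(t − s)` for `0 < s ≤ t`. [folklore] -/
private theorem TimeIntAux.integral_Ioc_min {s t : ℝ} (hs0 : 0 ≤ s) (hst : s ≤ t) :
    ∫ u in Ioc 0 t, min s u = s ^ 2 / 2 + s * (t - s) := by
  have hcont : Continuous fun u : ℝ ↦ min s u := by fun_prop
  rw [← intervalIntegral.integral_of_le (hs0.trans hst),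
    ← intervalIntegral.integral_add_adjacent_intervals (b := s)
      (hcont.intervalIntegrable _ _) (hcont.intervalIntegrable _ _)]
  have h1 : ∫ u in (0 : ℝ)..s, min s u = s ^ 2 / 2 := by
    have : ∫ u in (0 : ℝ)..s, min s u = ∫ u in (0 : ℝ)..s, u :=
      intervalIntegral.integral_congr fun u hu ↦ by
        rw [uIcc_of_le hs0] at hu
        exact min_eq_right hu.2
    rw [this, integral_id]
    ring
  have h2 : ∫ u in s..t, min s u = s * (t - s) := by
    have : ∫ u in s..t, min s u = ∫ _ in s..t, s :=
      intervalIntegral.integral_congr fun u hu ↦ by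
        rw [uIcc_of_le hst] at hu
        exact min_eq_left hu.1
    rw [this, intervalIntegral.integral_const, smul_eq_mul]
    ring
  rw [h1, h2]

/-- **`∫_{(0,t]} ∫_{(0,t]} min(s, u) du ds = t³/3`** (`= ∫₀ᵗ (s²/2 + s(t−s)) ds = t³/2 − t³/6`):
the value of `EW² = ∫₀ᵗ∫₀ᵗ E(B_s B_u) du ds` in Exercise 7.1.3. [cite: Durrett2019, Ex. 7.1.3] -/
theorem integral_Ioc_integral_Ioc_min {t : ℝ} (ht : 0 ≤ t) :
    ∫ s in Ioc 0 t, ∫ u in Ioc 0 t, min s u = t ^ 3 / 3 := by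
  rw [setIntegral_congr_fun measurableSet_Ioc
    (fun s hs ↦ TimeIntAux.integral_Ioc_min hs.1.le hs.2),
    ← intervalIntegral.integral_of_le ht]
  have : ∀ s : ℝ, s ^ 2 / 2 + s * (t - s) = t * s - s ^ 2 / 2 := fun s ↦ by ring
  simp_rw [this]
  rw [intervalIntegral.integral_sub, intervalIntegral.integral_const_mul, integral_id,
    intervalIntegral.integral_div, integral_pow]
  · ring
  · exact (continuous_const_mul t).intervalIntegrable _ _
  · exact (by fun_prop : Continuous fun x : ℝ ↦ x ^ 2 / 2).intervalIntegrable _ _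

/-- Joint integrability of `((s, u), ω) ↦ B_s ω B_u ω` on `(0,t]² × Ω`. [folklore] -/
private theorem TimeIntAux.integrable_mul_prod (hB : IsPreBrownianReal B P)
    (hmeas : Measurable (uncurry B)) (t : ℝ) :
    Integrable (uncurry fun (z : ℝ × ℝ) (ω : Ω) ↦ B z.1.toNNReal ω * B z.2.toNNReal ω)
      (((volume.restrict (Ioc 0 t)).prod (volume.restrict (Ioc 0 t))).prod P) := by
  haveI := hB.isGaussianProcess.isProbabilityMeasure
  have h1 : Measurable fun p : (ℝ × ℝ) × Ω ↦ B p.1.1.toNNReal p.2 :=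
    hmeas.comp ((measurable_real_toNNReal.comp (measurable_fst.comp measurable_fst)).prodMk
      measurable_snd)
  have h2 : Measurable fun p : (ℝ × ℝ) × Ω ↦ B p.1.2.toNNReal p.2 :=
    hmeas.comp ((measurable_real_toNNReal.comp (measurable_snd.comp measurable_fst)).prodMk
      measurable_snd)
  have hm : Measurable (uncurry fun (z : ℝ × ℝ) (ω : Ω) ↦ B z.1.toNNReal ω * B z.2.toNNReal ω) :=
    h1.mul h2
  refine (integrable_prod_iff hm.aestronglyMeasurable).2
    ⟨Eventually.of_forall fun z ↦ ?_, ?_⟩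
  · simp only [uncurry_apply_pair]
    exact TimeIntAux.integrable_mul_eval hB _ _
  refine Integrable.mono' (g := fun _ ↦ max t 0) (integrable_const _)
    hm.aestronglyMeasurable.norm.integral_prod_right' ?_
  rw [Measure.prod_restrict]
  refine (ae_restrict_mem (measurableSet_Ioc.prod measurableSet_Ioc)).mono fun z hz ↦ ?_
  simp only [uncurry_apply_pair]
  rw [Real.norm_eq_abs, abs_of_nonneg (integral_nonneg fun _ ↦ norm_nonneg _)]
  refine (TimeIntAux.integral_abs_mul_le hB _ _).trans ?_
  obtain ⟨⟨h1l, h1r⟩, ⟨h2l, h2r⟩⟩ := hz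
  rw [Real.coe_toNNReal _ h1l.le, Real.coe_toNNReal _ h2l.le]
  have := le_max_left t 0
  linarith

/-- **Exercise 7.1.3, `EW² = t³/3`**: for a jointly measurable pre-Brownian motion and `t ≥ 0`,
`E (∫_{(0,t]} B_s ds)² = ∫_{(0,t]}∫_{(0,t]} E[B_s B_u] du ds = ∫∫ min(s,u) = t³/3`.
[cite: Durrett2019, Ex. 7.1.3] -/
theorem _root_.ProbabilityTheory.IsPreBrownianReal.integral_timeIntegral_sq
    (hB : IsPreBrownianReal B P) (hmeas : Measurable (uncurry B)) {t : ℝ} (ht : 0 ≤ t) :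
    ∫ ω, (∫ s in Ioc 0 t, B s.toNNReal ω) ^ 2 ∂P = t ^ 3 / 3 := by
  haveI := hB.isGaussianProcess.isProbabilityMeasure
  -- the square as a double integral
  have hsq : ∀ ω, (∫ s in Ioc 0 t, B s.toNNReal ω) ^ 2 =
      ∫ z, B z.1.toNNReal ω * B z.2.toNNReal ω
        ∂((volume.restrict (Ioc 0 t)).prod (volume.restrict (Ioc 0 t))) := fun ω ↦ by
    rw [sq, ← integral_prod_mul]
  simp_rw [hsq]
  -- Fubini
  rw [← integral_integral_swap (TimeIntAux.integrable_mul_prod hB hmeas t)]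
  have hinner : ∀ z : ℝ × ℝ, ∫ ω, B z.1.toNNReal ω * B z.2.toNNReal ω ∂P =
      min (max z.1 0) (max z.2 0) := fun z ↦ by
    rw [hB.integral_mul_eval, Real.coe_toNNReal', Real.coe_toNNReal']
  simp_rw [hinner]
  -- the calculus
  have hint : Integrable (fun z : ℝ × ℝ ↦ min (max z.1 0) (max z.2 0))
      ((volume.restrict (Ioc 0 t)).prod (volume.restrict (Ioc 0 t))) := by
    refine Integrable.mono' (g := fun _ ↦ max t 0) (integrable_const _)
      (Measurable.aestronglyMeasurable (by fun_prop)) ?_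
    rw [Measure.prod_restrict]
    refine (ae_restrict_mem (measurableSet_Ioc.prod measurableSet_Ioc)).mono fun z hz ↦ ?_
    obtain ⟨⟨h1l, h1r⟩, ⟨h2l, h2r⟩⟩ := hz
    rw [Real.norm_eq_abs, abs_of_nonneg (le_min (le_max_right _ _) (le_max_right _ _)),
      max_eq_left h1l.le, max_eq_left h2l.le]
    exact (min_le_left _ _).trans (h1r.trans (le_max_left _ _))
  rw [integral_prod _ hint]
  show ∫ s in Ioc 0 t, (∫ u in Ioc 0 t, min (max s 0) (max u 0)) = t ^ 3 / 3
  have hcongr : ∀ s ∈ Ioc (0 : ℝ) t, ∫ u in Ioc 0 t, min (max s 0) (max u 0) =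
      ∫ u in Ioc 0 t, min s u := fun s hs ↦
    setIntegral_congr_fun measurableSet_Ioc fun u hu ↦ by
      show min (max s 0) (max u 0) = min s u
      rw [max_eq_left hs.1.le, max_eq_left hu.1.le]
  rw [setIntegral_congr_fun measurableSet_Ioc hcongr]
  exact integral_Ioc_integral_Ioc_min ht

/-! ### §4 The canonical Brownian motion -/

/-- The canonical Brownian motion is jointly measurable in `(s, ω)` (continuous paths, measurable
marginals; cf. the tree's `measurable_uncurry_brownian` in `BrownianConcatenation.lean`, not
imported here to keep the import cone small). [folklore] -/
private theorem TimeIntAux.measurable_uncurry_brownian' : Measurable (uncurry brownian) :=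
  measurable_uncurry_of_continuous_of_measurable continuous_brownian measurable_brownian

/-- **Durrett (2019), Exercise 7.1.3, `EW = 0`** for the canonical Brownian motion:
`E ∫_{(0,t]} B_s ds = 0`. [cite: Durrett2019, Ex. 7.1.3] -/
theorem Durrett2019_exercise_7_1_3_mean (t : ℝ) :
    ∫ ω, (∫ s in Ioc 0 t, brownian s.toNNReal ω) ∂preWienerMeasure = 0 :=
  RandomPlanarGeometry.isPreBrownianReal_brownian.integral_timeIntegral_eq_zero
    TimeIntAux.measurable_uncurry_brownian' t

/-- **Durrett (2019), Exercise 7.1.3, `EW² = t³/3`** for the canonical Brownian motion: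
`E (∫_{(0,t]} B_s ds)² = t³/3`, `t ≥ 0`. [cite: Durrett2019, Ex. 7.1.3] -/
theorem Durrett2019_exercise_7_1_3_sq {t : ℝ} (ht : 0 ≤ t) :
    ∫ ω, (∫ s in Ioc 0 t, brownian s.toNNReal ω) ^ 2 ∂preWienerMeasure = t ^ 3 / 3 :=
  RandomPlanarGeometry.isPreBrownianReal_brownian.integral_timeIntegral_sq
    TimeIntAux.measurable_uncurry_brownian' ht

end Literature.Probability.Process
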